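import Mathlib.Analysis.Calculus.Deriv.Pow
import Mathlib.Analysis.Calculus.Deriv.Mul
import Mathlib.Analysis.Calculus.Deriv.Add
import Mathlib.Analysis.Calculus.IteratedDeriv.Defs
import Mathlib.Analysis.SpecialFunctions.Pow.Deriv
import Mathlib.Analysis.Complex.RealDeriv
import HarnessLib

/-!
# The Laplacian of the disk monomials `z^m z̄^n` and the explicit Dirichlet inverse

Topic `Literature/Analysis/ValidatedNumerics`. Computer-assisted proofs for elliptic problems on the unit
disk `𝔻 ⊂ ℂ` (Arioli–Koch, *Nonlinear Anal.* 179 (2019) §2–3, Zernike/disk-polynomial algebras; the certnum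
F2 (B″) «cone algebra» of monomials `ζ^aζ̄^b` with weight `ϱ^{a+b}`) expand functions in the monomials
`M_{m,n}(z) = z^m z̄^n` and invert the Dirichlet Laplacian TERMWISE by the elementary identity

  `Δ (z^{a+1} z̄^{b+1}) = 4(a+1)(b+1) z^a z̄^b`,  `Δ z^k = Δ z̄^k = 0`,

so that `w := (z^{a+1} z̄^{b+1} − z^{a−b}) / (4(a+1)(b+1))` (for `b ≤ a`; conjugate otherwise) satisfies
`Δw = z^a z̄^b` in `𝔻` and `w = 0` on `∂𝔻` (because `z z̄ = 1` there). This file PROVES these identities with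
the Laplacian written CONCRETELY as the sum of the two directional second derivatives along `1` and `I`
(`lapRI f z = ∂²_t f(z + t)|₀ + ∂²_t f(z + tI)|₀`, real `t`) — no manifold or distribution theory is needed,
and this is exactly the form a replay of the certificates can check symbol by symbol:

* `hasDerivAt_monoPath` — derivative of `t ↦ K (z + t c)^m (w + t d)^n` (real `t`, complex constants);
* `iteratedDeriv_two_monoPath` — its second derivative at `t = 0`;
* `lapRI_monomial` — **`lapRI (z ↦ z^m z̄^n) z = 4 m n z^{m−1} z̄^{n−1}`** (all `m n : ℕ`; in particular
  `z^m` and `z̄^n` are harmonic);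
* `monomial_boundary` — on `‖z‖ = 1`: `z^{a+1} z̄^{b+1} = z^{a−b}` (`b ≤ a`) and `= z̄^{b−a}` (`a ≤ b`);
* `dirichletInverse_weight_le` (appended 2026-08-27) — the far-column weight bound
  `(ϱ^{a+b+2} + ϱ^{a−b})/(4(a+1)(b+1)) ≤ ϱ^{a+b}(ϱ²+1)/(4(N+2))` for `a + b ≥ N + 1`, `ϱ ≥ 1`.

WHAT THIS IS NOT: no statement here that `lapRI` agrees with an abstract Laplacian for general `C²`
functions (for polynomials in `z, z̄` it is the classical `∂²_x + ∂²_y` by definition of directional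
derivatives; the agreement with Mathlib's `Δ` on `C²` maps is typed downstream, in
`Literature/Analysis/Complex/LaplacianConformalPullback.lean`, `ConformalLaplacian.lapRI_eq_laplacian`);
no function spaces, no convergence of the termwise inverse on the weighted `ℓ¹` algebra — only the
per-column weight inequality behind the operator-norm bound (`‖Δ_D⁻¹ e_{ab}‖_ϱ ≤ ϱ^{a+b}(ϱ²+1)/(4(N+2))` on
the far columns, Arioli–Koch Prop. 3.2 analogue / the certnum producer's `Z_far` constant) is typed, as the
real inequality `dirichletInverse_weight_le`; the `ℓ¹_ϱ` operator statement is its column supremum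
(`Literature/Analysis/ValidatedNumerics/WeightedEllOneSequenceAlgebra`). SOURCE: G. Arioli, H. Koch, *Non-radial solutions for some semilinear
elliptic equations on the disk*, Nonlinear Anal. 179 (2019) 294–308, §2 (eq. (2.6) disk polynomials
`P_n = (zz̄−1)^n/n!`, eq. (2.7) `z, z̄` as independent variables, eq. (2.10) `∂_z∂_z̄ P_k`, Lemma 2.1 the Dirichlet
inverse in the Zernike basis) — this file is the plain-monomial version of that calculus.
[cite: ArioliKoch2019, §2 eqs. (2.6)–(2.10), Lemma 2.1]
-/

noncomputable section

open Complex

namespace Literature.Analysis.ValidatedNumerics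

namespace ConeMonomial

/-- The planar Laplacian of `f : ℂ → ℂ` at `z`, written as the sum of the second directional derivatives
along the real and the imaginary axis: `Δf(z) = ∂²_t f(z + t)|_{t=0} + ∂²_t f(z + tI)|_{t=0}` (`t` real).
[folklore] -/
def lapRI (f : ℂ → ℂ) (z : ℂ) : ℂ :=
  iteratedDeriv 2 (fun t : ℝ => f (z + t)) 0 + iteratedDeriv 2 (fun t : ℝ => f (z + t * I)) 0

/-- The disk monomial `M_{m,n}(z) = z^m · z̄^n`. [folklore] -/
def monomial (m n : ℕ) (z : ℂ) : ℂ := z ^ m * (starRingEnd ℂ z) ^ n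

/-- The real path `t ↦ z + t·c` has derivative `c` (private helper). [folklore] -/
private theorem hasDerivAt_linePath (z c : ℂ) (t : ℝ) :
    HasDerivAt (fun s : ℝ => z + (s : ℂ) * c) c t := by
  have h1 : HasDerivAt (fun s : ℝ => ((s : ℝ) : ℂ)) ((1 : ℝ) : ℂ) t := (hasDerivAt_id t).ofReal_comp
  have h2 := (h1.mul_const c).const_add z
  simpa using h2

/-- Derivative of the product path `t ↦ K · (z + t c)^m · (w + t d)^n` (real `t`; `K, z, w, c, d ∈ ℂ`, `m n : ℕ`):
`K · (m c (z+tc)^{m−1}(w+td)^n + n d (z+tc)^m (w+td)^{n−1})` (private helper). [folklore] -/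
private theorem hasDerivAt_monoPath (K z w c d : ℂ) (m n : ℕ) (t : ℝ) :
    HasDerivAt (fun s : ℝ => K * ((z + (s : ℂ) * c) ^ m * (w + (s : ℂ) * d) ^ n))
      (K * ((m : ℂ) * (z + (t : ℂ) * c) ^ (m - 1) * c * (w + (t : ℂ) * d) ^ n
        + (z + (t : ℂ) * c) ^ m * ((n : ℂ) * (w + (t : ℂ) * d) ^ (n - 1) * d))) t := by
  have hz := (hasDerivAt_linePath z c t).pow m
  have hw := (hasDerivAt_linePath w d t).pow n
  exact (hz.mul hw).const_mul K

/-- The second derivative at `t = 0` of `t ↦ (z + tc)^m (w + td)^n`: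
`m(m−1)c² z^{m−2}w^n + 2mn·cd·z^{m−1}w^{n−1} + n(n−1)d² z^m w^{n−2}` (private helper). [folklore] -/
private theorem iteratedDeriv_two_monoPath (z w c d : ℂ) (m n : ℕ) :
    iteratedDeriv 2 (fun s : ℝ => (z + (s : ℂ) * c) ^ m * (w + (s : ℂ) * d) ^ n) 0
      = (m : ℂ) * ((m - 1 : ℕ) : ℂ) * c ^ 2 * z ^ (m - 1 - 1) * w ^ n
        + 2 * (m : ℂ) * (n : ℂ) * c * d * z ^ (m - 1) * w ^ (n - 1)
        + (n : ℂ) * ((n - 1 : ℕ) : ℂ) * d ^ 2 * z ^ m * w ^ (n - 1 - 1) := by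
  rw [show (2 : ℕ) = 1 + 1 from rfl, iteratedDeriv_succ, iteratedDeriv_one]
  -- first derivative as a function
  have h1 : deriv (fun s : ℝ => (z + (s : ℂ) * c) ^ m * (w + (s : ℂ) * d) ^ n)
      = fun s : ℝ => (m : ℂ) * c * ((z + (s : ℂ) * c) ^ (m - 1) * (w + (s : ℂ) * d) ^ n)
          + (n : ℂ) * d * ((z + (s : ℂ) * c) ^ m * (w + (s : ℂ) * d) ^ (n - 1)) := by
    funext s
    have h := hasDerivAt_monoPath 1 z w c d m n s
    simp only [one_mul] at h
    rw [h.deriv]; ring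
  rw [h1]
  -- second derivative at 0 from the two product paths
  have hA := hasDerivAt_monoPath ((m : ℂ) * c) z w c d (m - 1) n 0
  have hB := hasDerivAt_monoPath ((n : ℂ) * d) z w c d m (n - 1) 0
  rw [(hA.fun_add hB).deriv]
  simp only [ofReal_zero, zero_mul, add_zero]
  push_cast
  ring

/-- **Laplacian of the disk monomials:** `Δ(z^m z̄^n) = 4 m n · z^{m−1} z̄^{n−1}` for all `m n : ℕ` (so `z^m` and `z̄^n`
are harmonic, and `Δ(z^{a+1} z̄^{b+1}) = 4(a+1)(b+1) z^a z̄^b`). Here `Δ = lapRI` (directional form) and the proof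
is the observation `conj (z + t c) = z̄ + t c̄` for real `t`, with `(c, c̄) = (1, 1)` and `(I, −I)`: the `c²`- and
`c̄²`-terms of the two directions cancel (`1 + I² = 0`) and the cross terms add (`1·1 + I·(−I) = 2`). This is the
monomial instance of the `∂_z∂_z̄ = Δ/4` calculus on polynomials in `(z, z̄)` that Arioli–Koch use for the disk
(treating `z, z̄` as independent variables, eq. (2.7), and `∂_z∂_z̄` of the disk polynomials, eq. (2.10)).
[cite: ArioliKoch2019, §2 eqs. (2.7)–(2.10) (∂_z∂_z̄-calculus on disk polynomials; Δ = 4∂_z∂_z̄)] -/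
theorem lapRI_monomial (m n : ℕ) (z : ℂ) :
    lapRI (monomial m n) z = 4 * (m : ℂ) * (n : ℂ) * z ^ (m - 1) * (starRingEnd ℂ z) ^ (n - 1) := by
  unfold lapRI monomial
  have hconj : ∀ (s : ℝ) (c : ℂ), starRingEnd ℂ (z + (s : ℂ) * c) = starRingEnd ℂ z + (s : ℂ) * starRingEnd ℂ c := by
    intro s c
    simp [map_add, map_mul, Complex.conj_ofReal]
  have e1 : (fun t : ℝ => (z + (t : ℂ)) ^ m * starRingEnd ℂ (z + (t : ℂ)) ^ n)
      = fun t : ℝ => (z + (t : ℂ) * 1) ^ m * (starRingEnd ℂ z + (t : ℂ) * 1) ^ n := by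
    funext t
    have := hconj t 1
    simp only [mul_one, map_one] at this ⊢
    rw [this]
  have e2 : (fun t : ℝ => (z + (t : ℂ) * I) ^ m * starRingEnd ℂ (z + (t : ℂ) * I) ^ n)
      = fun t : ℝ => (z + (t : ℂ) * I) ^ m * (starRingEnd ℂ z + (t : ℂ) * (-I)) ^ n := by
    funext t
    rw [hconj t I, Complex.conj_I]
  rw [e1, e2, iteratedDeriv_two_monoPath, iteratedDeriv_two_monoPath]
  have hI : I ^ 2 = -1 := Complex.I_sq
  set w := starRingEnd ℂ z
  ring_nf
  rw [hI]
  ring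

/-- **Boundary values on the unit circle:** if `‖z‖ = 1` then `z^{a+1} z̄^{b+1} = z^{a−b}` for `b ≤ a` — so
`w = (z^{a+1} z̄^{b+1} − z^{a−b})/(4(a+1)(b+1))` VANISHES on `∂𝔻` while `Δw = z^a z̄^b` by `lapRI_monomial`
(the termwise Dirichlet inverse of the cone algebra — the monomial counterpart of Arioli–Koch's Lemma 2.1, whose disk
polynomials `P_n = (z z̄ − 1)^n/n!` (eq. (2.6)) vanish on `∂𝔻` for the same reason `z z̄ = 1`).
[cite: ArioliKoch2019, §2 eq. (2.6) and Lemma 2.1 (Dirichlet inverse on disk polynomials)] -/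
theorem monomial_boundary {z : ℂ} (hz : ‖z‖ = 1) {a b : ℕ} (hba : b ≤ a) :
    z ^ (a + 1) * (starRingEnd ℂ z) ^ (b + 1) = z ^ (a - b) := by
  have hzc : z * starRingEnd ℂ z = 1 := by
    rw [Complex.mul_conj, Complex.normSq_eq_norm_sq, hz]; simp
  obtain ⟨k, rfl⟩ := Nat.exists_eq_add_of_le hba
  have : z ^ (b + k + 1) * (starRingEnd ℂ z) ^ (b + 1) = z ^ k * (z * starRingEnd ℂ z) ^ (b + 1) := by ring
  rw [this, hzc, one_pow, mul_one, Nat.add_sub_cancel_left]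

/-- Conjugate case of `monomial_boundary`: if `‖z‖ = 1` and `a ≤ b` then `z^{a+1} z̄^{b+1} = z̄^{b−a}`.
[cite: ArioliKoch2019, §2 eq. (2.6) and Lemma 2.1 (Dirichlet inverse on disk polynomials)] -/
theorem monomial_boundary' {z : ℂ} (hz : ‖z‖ = 1) {a b : ℕ} (hab : a ≤ b) :
    z ^ (a + 1) * (starRingEnd ℂ z) ^ (b + 1) = (starRingEnd ℂ z) ^ (b - a) := by
  have hzc : z * starRingEnd ℂ z = 1 := by
    rw [Complex.mul_conj, Complex.normSq_eq_norm_sq, hz]; simp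
  obtain ⟨k, rfl⟩ := Nat.exists_eq_add_of_le hab
  have : z ^ (a + 1) * (starRingEnd ℂ z) ^ (a + k + 1) = (starRingEnd ℂ z) ^ k * (z * starRingEnd ℂ z) ^ (a + 1) := by ring
  rw [this, hzc, one_pow, mul_one, Nat.add_sub_cancel_left]

/-- **`ϱ`-norm of the termwise Dirichlet inverse on the far columns** (case `b ≤ a`). In the weighted
algebra `‖Σ u_{ab} z^a z̄^b‖_ϱ = Σ |u_{ab}| ϱ^{a+b}` (`ϱ ≥ 1`) the Dirichlet inverse
`w = (z^{a+1} z̄^{b+1} − z^{a−b})/(4(a+1)(b+1))` of the monomial `z^a z̄^b` (`lapRI_monomial`,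
`monomial_boundary`) has norm `(ϱ^{a+b+2} + ϱ^{a−b})/(4(a+1)(b+1))`, and on every column of total
degree `a + b ≥ N + 1` this is at most `ϱ^{a+b} · (ϱ²+1)/(4(N+2))` — i.e. `‖Δ_D⁻¹ e_{ab}‖_ϱ / ‖e_{ab}‖_ϱ
≤ (ϱ²+1)/(4(N+2))` uniformly in the far columns (the constant of the certnum producer's `Z_far`). This is
the monomial-basis analogue, obtained the same way from the explicit inverse, of Arioli–Koch's
Zernike-basis bound `‖Δ⁻¹(I − P_N)‖ ≤ (ρ + ρ⁻¹)²/(4N(N+2))` (there `Δ⁻¹V_n^m = c₂V_{n+2}^m + c₁V_n^m +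
c₀V_{n−2}^m`, Lemma 2.1, gives the extra factor `1/N`; plain monomials only give `(a+1)(b+1) ≥ a+b+1`).
[cite: ArioliKoch2019, Prop. 3.2 eq. (3.7) (Zernike form (ρ+ρ⁻¹)²/(4N(N+2)); monomial-basis analogue via Lemma 2.1)] -/
theorem dirichletInverse_weight_le {ϱ : ℝ} (hϱ : 1 ≤ ϱ) {a b N : ℕ} (hba : b ≤ a)
    (hN : N + 1 ≤ a + b) :
    (ϱ ^ (a + b + 2) + ϱ ^ (a - b)) / (4 * ((a : ℝ) + 1) * ((b : ℝ) + 1))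
      ≤ ϱ ^ (a + b) * ((ϱ ^ 2 + 1) / (4 * ((N : ℝ) + 2))) := by
  have hϱ0 : 0 < ϱ := lt_of_lt_of_le one_pos hϱ
  have hpow : ϱ ^ (a - b) ≤ ϱ ^ (a + b) := pow_le_pow_right₀ hϱ (by omega)
  have hnum : ϱ ^ (a + b + 2) + ϱ ^ (a - b) ≤ ϱ ^ (a + b) * (ϱ ^ 2 + 1) := by
    rw [pow_add]; nlinarith
  have hden : 4 * ((N : ℝ) + 2) ≤ 4 * ((a : ℝ) + 1) * ((b : ℝ) + 1) := by
    have h1 : (N : ℝ) + 1 ≤ (a : ℝ) + (b : ℝ) := by exact_mod_cast hN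
    have ha : (0 : ℝ) ≤ a := Nat.cast_nonneg a
    have hb : (0 : ℝ) ≤ b := Nat.cast_nonneg b
    nlinarith [mul_nonneg ha hb]
  have hdenpos : 0 < 4 * ((N : ℝ) + 2) := by positivity
  rw [← mul_div_assoc]
  exact div_le_div₀ (by positivity) hnum hdenpos hden

/-- Conjugate case of `dirichletInverse_weight_le` (`a ≤ b`, inverse
`(z^{a+1} z̄^{b+1} − z̄^{b−a})/(4(a+1)(b+1))`, `monomial_boundary'`): on the far columns `a + b ≥ N + 1`,
`(ϱ^{a+b+2} + ϱ^{b−a})/(4(a+1)(b+1)) ≤ ϱ^{a+b}(ϱ²+1)/(4(N+2))`.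
[cite: ArioliKoch2019, Prop. 3.2 eq. (3.7) (Zernike form; monomial-basis analogue via Lemma 2.1)] -/
theorem dirichletInverse_weight_le' {ϱ : ℝ} (hϱ : 1 ≤ ϱ) {a b N : ℕ} (hab : a ≤ b)
    (hN : N + 1 ≤ a + b) :
    (ϱ ^ (a + b + 2) + ϱ ^ (b - a)) / (4 * ((a : ℝ) + 1) * ((b : ℝ) + 1))
      ≤ ϱ ^ (a + b) * ((ϱ ^ 2 + 1) / (4 * ((N : ℝ) + 2))) := by
  have h := dirichletInverse_weight_le (N := N) hϱ hab (by omega)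
  have e1 : b + a = a + b := Nat.add_comm b a
  rw [e1] at h
  have e2 : 4 * ((b : ℝ) + 1) * ((a : ℝ) + 1) = 4 * ((a : ℝ) + 1) * ((b : ℝ) + 1) := by ring
  rw [e2] at h
  exact h

end ConeMonomial

end Literature.Analysis.ValidatedNumerics
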